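import Summits.CriticalPhenomena.PercolationContinuityZ3.Theses.PercMonotoneFactors
import Summits.CriticalPhenomena.PercolationContinuityZ3.Theorems.PercMonotoneFactorsClassUniquenessFactor
import Literature.Probability.Percolation.UniquenessSandwichTolerant

/-!
# `ClassUniqueness` (route PercMonotoneFactors, item stmt-CriticalPhenomena-4493)

Settles the support item `ClassUniqueness` of route `PercMonotoneFactors`: for every admissible
block rule `F` on bond configurations of `ℤ³` (measurable, monotone, `F ∅ = ∅`, `F E = E`,
`E`-supported, `Aut(ℤ³)`-equivariant, local of range `R`) and every `0 < t < 1`, the block-factor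
law `μ_t^F = F_* P_t` almost surely has at most one infinite open cluster.

Proof: the Burton–Keane / Bollobás–Riordan argument with CUT CLUSTERS in place of cut-balls and
the SANDWICH insertion tolerance of `μ_t^F` — opening all labels of `Λ_{N+R+1}` opens every output
edge of `Λ_N` and perturbs only output edges of `Λ_{N+2R+2}` — i.e. the tree theorem
`Literature.Probability.Percolation.ae_numInfiniteClusters_le_one_of_sandwich`
(`UniquenessSandwichTolerant.lean`) fed with the four properties of the factor law proved in
`PercMonotoneFactorsClassUniquenessFactor.lean`. The hypotheses `F ∅ = ∅` and `t < 1` of the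
item are not needed.
-/

noncomputable section

namespace Summit.CriticalPhenomena.PercolationContinuityZ3.Theorems

open MeasureTheory ProbabilityTheory
open Literature.Probability.Percolation Literature.Probability.LatticeModels

/-- **`ClassUniqueness`** (settles `stmt-CriticalPhenomena-4493`, exact signature): for every
admissible block rule `F` on `ℤ³` and `0 < t < 1`, `μ_t^F`-almost surely there is at most one
infinite open cluster — uniqueness of the infinite cluster for monotone finite-range factors of
Bernoulli bond percolation (Burton–Keane with encounter regions at the label level: the factor law
is translation invariant, ergodic, lattice supported and sandwich insertion tolerant).
[folklore] -/
theorem classUniqueness_proof :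
    Summit.CriticalPhenomena.PercolationContinuityZ3.Theses.PercMonotoneFactors.ClassUniqueness := by
  unfold Summit.CriticalPhenomena.PercolationContinuityZ3.Theses.PercMonotoneFactors.ClassUniqueness
  intro R F hF hmono _ hE hsupp hequiv hloc t ht0 _
  haveI : IsProbabilityMeasure ((bondPercolation (zdGraph 3) t).map F) :=
    Measure.isProbabilityMeasure_map hF.aemeasurable
  refine ae_numInfiniteClusters_le_one_of_sandwich ((bondPercolation (zdGraph 3) t).map F) ?_ ?_ ?_ ?_
  · exact factorLaw_ae_subset hF hsupp t
  · exact factorLaw_measurePreserving_shift hF hequiv t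
  · exact fun S hS hinv => factorLaw_zero_one (by norm_num) hF hequiv t S hS hinv
  · exact factorLaw_sandwich hF hmono hE hsupp hloc ht0

end Summit.CriticalPhenomena.PercolationContinuityZ3.Theorems

end
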